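import Mathlib.Analysis.SpecialFunctions.Integrals.Basic
import Literature.Geometry.Lorentzian.KerrHyperboloidalLeaves
import Literature.Geometry.Lorentzian.KerrDataProofs
import Literature.Geometry.Lorentzian.KerrSeparatedPotential
import Literature.Geometry.Lorentzian.KerrSurfaceGravity
import HarnessLib

/-!
# The coordinate ellipsoid `{t* = 0, r = r₀}` of the Kerr–Schild slice: induced `2`-metric, area

(namespace `Literature.Geometry.Lorentzian.Kerr`; uses `Kerr.bilin`, `Kerr.nullCovector`, `Kerr.scalarH`,
`Kerr.radius` (`KerrSchild.lean`), `Kerr.blSigma` (`KerrHyperboloidalLeaves.lean`), `Kerr.delta`.)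

Kerr–Schild computations on the ellipsoid `S_{r₀} = {t* = 0, r = r₀}` in Kerr's oblate spheroidal
parametrisation `y(ϑ, φ) = ((r₀ cos φ − a sin φ) sin ϑ, (r₀ sin φ + a cos φ) sin ϑ, r₀ cos ϑ)`
(Visser arXiv:0706.0622, (30); O'Neill 1995, Ch. 2 §2.1): `spheroidalY` and its coordinate tangents
`spheroidalDTheta = ∂_ϑ y`, `spheroidalDPhi = ∂_φ y`; `r(0, y) = r₀`, `Σ = r₀² + a² cos² ϑ`,
`H = M r₀/Σ`; on `S_{r₀}` the spatial null vector `ℓ⃗` is the unit radial direction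
`(cos φ sin ϑ, sin φ sin ϑ, cos ϑ)`, so `ℓ(∂_ϑ) = 0`, `ℓ(∂_φ) = −a sin² ϑ`, and the induced `2`-metric
of `g = η + 2H ℓ ⊗ ℓ` on `(∂_ϑ, ∂_φ)` is the Boyer–Lindquist `t`-section metric of `{r = r₀}`
(Wald 1984, (12.3.1)): `g_{ϑϑ} = Σ`, `g_{ϑφ} = 0`, `g_{φφ} = ((r₀² + a²)² − Δ a² sin² ϑ) sin² ϑ/Σ`,
Gram determinant `((r₀² + a²)² − Δ(r₀) a² sin² ϑ) sin² ϑ ≥ (r₀² + a²)² sin² ϑ` wherever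
`Δ(r₀) ≤ 0`, `= (2 M r₊)² sin² ϑ` at `r₀ = r₊`. Integrated: the coordinate area
`sectionArea M a r₀ = 2π ∫₀^π √gram dϑ` satisfies `4π(r₀² + a²) ≤ sectionArea` for `Δ(r₀) ≤ 0`
(inside the hole the coordinate spheres dominate the round sphere of area radius `√(r₀² + a²)`)
and `sectionArea M a r₊ = 8π M r₊ = 4π(r₊² + a²)` (the Kerr horizon area, Wald 1984, (12.5.21)).

Not here: the identification of `sectionArea` with the Riemannian area of `S_{r₀}` (area
formula); trappedness of `S_{r₀}`, `r₋ < r₀ < r₊`, via null expansions (needs `Kerr.sliceK` for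
`a ≠ 0`); the collar radius `r₊ − θ √(M² − a²)` and the collar sphere in `Kerr.data`
(`KerrTrappedCollarRadius.lean`).

References: Wald, *General Relativity* (1984), §12.3 (12.3.1), §12.5 (12.5.21) (`Wald1984GR`);
Visser, arXiv:0706.0622, (29)–(35) (`arXiv07060622`); O'Neill, *The geometry of Kerr black holes*
(1995), Ch. 2 §2.1–2.5 (`ONeill1995`); Dafermos–Rodnianski–Shlapentokh-Rothman arXiv:1402.7034, §2.1.
-/

noncomputable section

open Real Set

namespace Literature.Geometry.Lorentzian

namespace Kerr

/-! ## The spheroidal parametrisation and the induced `2`-metric of `{t* = 0, r = r₀}` -/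

/-- The point `y(ϑ, φ) = ((r₀ cos φ − a sin φ) sin ϑ, (r₀ sin φ + a cos φ) sin ϑ, r₀ cos ϑ)` of
the coordinate ellipsoid `{t* = 0, r = r₀}` (`x + iy = (r + ia) e^{iφ} sin ϑ`, `z = r cos ϑ`: Kerr's
oblate spheroidal coordinates). Visser arXiv:0706.0622, (30). [cite: arXiv07060622, (30)] -/
def spheroidalY (a r₀ ϑ φ : ℝ) : E3 :=
  WithLp.toLp 2 ![(r₀ * cos φ - a * sin φ) * sin ϑ, (r₀ * sin φ + a * cos φ) * sin ϑ, r₀ * cos ϑ]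

/-- The coordinate tangent vector `∂_ϑ y(ϑ, φ)`. [folklore] -/
def spheroidalDTheta (a r₀ ϑ φ : ℝ) : E3 :=
  WithLp.toLp 2 ![(r₀ * cos φ - a * sin φ) * cos ϑ, (r₀ * sin φ + a * cos φ) * cos ϑ, -(r₀ * sin ϑ)]

/-- The coordinate tangent vector `∂_φ y(ϑ, φ)`. [folklore] -/
def spheroidalDPhi (a r₀ ϑ φ : ℝ) : E3 :=
  WithLp.toLp 2 ![-((r₀ * sin φ + a * cos φ) * sin ϑ), (r₀ * cos φ - a * sin φ) * sin ϑ, 0]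

section components

variable (a r₀ ϑ φ : ℝ)

/-- `y(ϑ, φ)₀ = (r₀ cos φ − a sin φ) sin ϑ`. [folklore] -/
@[simp] theorem spheroidalY_apply_zero :
    spheroidalY a r₀ ϑ φ 0 = (r₀ * cos φ - a * sin φ) * sin ϑ := rfl
/-- `y(ϑ, φ)₁ = (r₀ sin φ + a cos φ) sin ϑ`. [folklore] -/
@[simp] theorem spheroidalY_apply_one :
    spheroidalY a r₀ ϑ φ 1 = (r₀ * sin φ + a * cos φ) * sin ϑ := rfl
/-- `y(ϑ, φ)₂ = r₀ cos ϑ`. [folklore] -/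
@[simp] theorem spheroidalY_apply_two : spheroidalY a r₀ ϑ φ 2 = r₀ * cos ϑ := rfl
/-- `(∂_ϑ y)₀ = (r₀ cos φ − a sin φ) cos ϑ`. [folklore] -/
@[simp] theorem spheroidalDTheta_apply_zero :
    spheroidalDTheta a r₀ ϑ φ 0 = (r₀ * cos φ - a * sin φ) * cos ϑ := rfl
/-- `(∂_ϑ y)₁ = (r₀ sin φ + a cos φ) cos ϑ`. [folklore] -/
@[simp] theorem spheroidalDTheta_apply_one :
    spheroidalDTheta a r₀ ϑ φ 1 = (r₀ * sin φ + a * cos φ) * cos ϑ := rfl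
/-- `(∂_ϑ y)₂ = −r₀ sin ϑ`. [folklore] -/
@[simp] theorem spheroidalDTheta_apply_two : spheroidalDTheta a r₀ ϑ φ 2 = -(r₀ * sin ϑ) := rfl
/-- `(∂_φ y)₀ = −(r₀ sin φ + a cos φ) sin ϑ`. [folklore] -/
@[simp] theorem spheroidalDPhi_apply_zero :
    spheroidalDPhi a r₀ ϑ φ 0 = -((r₀ * sin φ + a * cos φ) * sin ϑ) := rfl
/-- `(∂_φ y)₁ = (r₀ cos φ − a sin φ) sin ϑ`. [folklore] -/
@[simp] theorem spheroidalDPhi_apply_one :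
    spheroidalDPhi a r₀ ϑ φ 1 = (r₀ * cos φ - a * sin φ) * sin ϑ := rfl
/-- `(∂_φ y)₂ = 0`. [folklore] -/
@[simp] theorem spheroidalDPhi_apply_two : spheroidalDPhi a r₀ ϑ φ 2 = 0 := rfl

end components

/-- `∂_ϑ y` is the `ϑ`-derivative of the parametrisation. [folklore] -/
theorem hasDerivAt_spheroidalY_theta (a r₀ ϑ φ : ℝ) :
    HasDerivAt (fun t ↦ spheroidalY a r₀ t φ) (spheroidalDTheta a r₀ ϑ φ) ϑ := by
  have hL := ((EuclideanSpace.equiv (Fin 3) ℝ).symm : (Fin 3 → ℝ) →L[ℝ] E3).hasFDerivAt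
    (x := ![(r₀ * cos φ - a * sin φ) * sin ϑ, (r₀ * sin φ + a * cos φ) * sin ϑ, r₀ * cos ϑ])
  have hg : HasDerivAt (fun t : ℝ ↦
      ![(r₀ * cos φ - a * sin φ) * sin t, (r₀ * sin φ + a * cos φ) * sin t, r₀ * cos t])
      ![(r₀ * cos φ - a * sin φ) * cos ϑ, (r₀ * sin φ + a * cos φ) * cos ϑ, -(r₀ * sin ϑ)] ϑ := by
    refine hasDerivAt_pi.2 fun i ↦ ?_
    fin_cases i
    · simpa using ((hasDerivAt_sin ϑ).const_mul (r₀ * cos φ - a * sin φ))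
    · simpa using ((hasDerivAt_sin ϑ).const_mul (r₀ * sin φ + a * cos φ))
    · simpa using ((hasDerivAt_cos ϑ).const_mul r₀)
  exact hL.comp_hasDerivAt ϑ hg

/-- `∂_φ y` is the `φ`-derivative of the parametrisation. [folklore] -/
theorem hasDerivAt_spheroidalY_phi (a r₀ ϑ φ : ℝ) :
    HasDerivAt (fun t ↦ spheroidalY a r₀ ϑ t) (spheroidalDPhi a r₀ ϑ φ) φ := by
  have hL := ((EuclideanSpace.equiv (Fin 3) ℝ).symm : (Fin 3 → ℝ) →L[ℝ] E3).hasFDerivAt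
    (x := ![(r₀ * cos φ - a * sin φ) * sin ϑ, (r₀ * sin φ + a * cos φ) * sin ϑ, r₀ * cos ϑ])
  have hg : HasDerivAt (fun t : ℝ ↦
      ![(r₀ * cos t - a * sin t) * sin ϑ, (r₀ * sin t + a * cos t) * sin ϑ, r₀ * cos ϑ])
      ![-((r₀ * sin φ + a * cos φ) * sin ϑ), (r₀ * cos φ - a * sin φ) * sin ϑ, 0] φ := by
    refine hasDerivAt_pi.2 fun i ↦ ?_
    fin_cases i
    · have := (((hasDerivAt_cos φ).const_mul r₀).sub ((hasDerivAt_sin φ).const_mul a)).mul_const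
        (sin ϑ)
      simpa using this.congr_deriv (by ring)
    · have := (((hasDerivAt_sin φ).const_mul r₀).add ((hasDerivAt_cos φ).const_mul a)).mul_const
        (sin ϑ)
      simpa using this.congr_deriv (by ring)
    · simpa using hasDerivAt_const φ (r₀ * cos ϑ)
  exact hL.comp_hasDerivAt φ hg

/-- `‖y(ϑ, φ)‖² = r₀² + a² sin² ϑ` (O'Neill 1995, Ch. 2 §2.1). [cite: ONeill1995, Ch. 2 §2.1] -/
theorem norm_sq_spheroidalY (a r₀ ϑ φ : ℝ) :
    ‖spheroidalY a r₀ ϑ φ‖ ^ 2 = r₀ ^ 2 + a ^ 2 * sin ϑ ^ 2 := by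
  rw [E3.norm_sq, spheroidalY_apply_zero, spheroidalY_apply_one, spheroidalY_apply_two]
  linear_combination (r₀ ^ 2 + a ^ 2) * sin ϑ ^ 2 * sin_sq_add_cos_sq φ +
    r₀ ^ 2 * sin_sq_add_cos_sq ϑ

/-- **`y(ϑ, φ)` lies on the ellipsoid `{r = r₀}`**: its Kerr–Schild radius is `r₀` (`0 < r₀`).
O'Neill 1995, Ch. 2 §2.1; Visser arXiv:0706.0622, (35). [cite: arXiv07060622, (35)] -/
theorem radius_spheroidalY (a : ℝ) {r₀ : ℝ} (hr : 0 < r₀) (ϑ φ : ℝ) :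
    radius a (E4.ofTimeSpace 0 (spheroidalY a r₀ ϑ φ)) = r₀ := by
  apply radius_eq_of_quartic hr
  rw [E4.spatialNorm_ofTimeSpace, norm_sq_spheroidalY,
    show (E4.ofTimeSpace 0 (spheroidalY a r₀ ϑ φ)) 3 = spheroidalY a r₀ ϑ φ 2 from
      E4.ofTimeSpace_apply_succ 0 _ 2, spheroidalY_apply_two]
  linear_combination (-(a ^ 2 * r₀ ^ 2)) * sin_sq_add_cos_sq ϑ

/-- `Σ = r₀² + a² cos² ϑ` at `y(ϑ, φ)` (`Kerr.blSigma = 2r² − ‖y‖² + a²`). DRSR arXiv:1402.7034,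
§2.1.1. [cite: DafermosRodnianskiShlapentokhrothman2014, §2.1.1] -/
theorem blSigma_spheroidalY (a : ℝ) {r₀ : ℝ} (hr : 0 < r₀) (ϑ φ : ℝ) :
    blSigma a (spheroidalY a r₀ ϑ φ) = r₀ ^ 2 + a ^ 2 * cos ϑ ^ 2 := by
  rw [blSigma, radius_spheroidalY a hr, norm_sq_spheroidalY]
  linear_combination (-(a ^ 2)) * sin_sq_add_cos_sq ϑ

/-- `0 < Σ` at `y(ϑ, φ)` for `0 < r₀`. [folklore] -/
theorem blSigma_spheroidalY_pos (a : ℝ) {r₀ : ℝ} (hr : 0 < r₀) (ϑ : ℝ) :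
    0 < r₀ ^ 2 + a ^ 2 * cos ϑ ^ 2 := by positivity

/-- `H = M r₀ / Σ` at `(0, y(ϑ, φ))` (Visser arXiv:0706.0622, (33)). [cite: arXiv07060622, (33)] -/
theorem scalarH_spheroidalY (M a : ℝ) {r₀ : ℝ} (hr : 0 < r₀) (ϑ φ : ℝ) :
    scalarH M a (E4.ofTimeSpace 0 (spheroidalY a r₀ ϑ φ)) =
      M * r₀ / (r₀ ^ 2 + a ^ 2 * cos ϑ ^ 2) := by
  have h := radius_spheroidalY a hr ϑ φ
  rw [scalarH_ofTimeSpace_eq 0 (by rw [h]; exact hr), h, blSigma_spheroidalY a hr]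

/-- The null covector on a tangent vector `(0, v)` of the slice at `(0, y)`: `ℓ(0, v) =
((r y₁ + a y₂) v₁ + (r y₂ − a y₁) v₂)/(r² + a²) + y₃ v₃ / r`. [cite: arXiv07060622, (34)] -/
theorem nullCovector_spaceEmbed (a : ℝ) (y v : E3) :
    nullCovector a (E4.ofTimeSpace 0 y) (E4.spaceEmbed v) =
      ((radius a (E4.ofTimeSpace 0 y) * y 0 + a * y 1) * v 0 +
          (radius a (E4.ofTimeSpace 0 y) * y 1 - a * y 0) * v 1) /
            (radius a (E4.ofTimeSpace 0 y) ^ 2 + a ^ 2) +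
        y 2 * v 2 / radius a (E4.ofTimeSpace 0 y) := by
  have h1 : ∀ w : E3, E4.ofTimeSpace 0 w 1 = w 0 := fun w ↦ E4.ofTimeSpace_apply_succ 0 w 0
  have h2 : ∀ w : E3, E4.ofTimeSpace 0 w 2 = w 1 := fun w ↦ E4.ofTimeSpace_apply_succ 0 w 1
  have h3 : ∀ w : E3, E4.ofTimeSpace 0 w 3 = w 2 := fun w ↦ E4.ofTimeSpace_apply_succ 0 w 2
  simp only [nullCovector, E4.covector_apply, Fin.sum_univ_four, nullCovectorFun,
    E4.spaceEmbed_apply, E4.ofTimeSpace_apply_zero, h1, h2, h3, Fin.isValue, Matrix.cons_val_zero,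
    Matrix.cons_val_one, Matrix.cons_val, mul_zero, zero_add]
  ring

/-- **On the ellipsoid `{r = r₀}` the spatial null vector is the unit "radial" direction**:
`ℓ(0, v) = cos φ sin ϑ v₁ + sin φ sin ϑ v₂ + cos ϑ v₃` at `(0, y(ϑ, φ))`. [cite: arXiv07060622, (34)] -/
theorem nullCovector_spheroidalY (a : ℝ) {r₀ : ℝ} (hr : 0 < r₀) (ϑ φ : ℝ) (v : E3) :
    nullCovector a (E4.ofTimeSpace 0 (spheroidalY a r₀ ϑ φ)) (E4.spaceEmbed v) =
      cos φ * sin ϑ * v 0 + sin φ * sin ϑ * v 1 + cos ϑ * v 2 := by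
  rw [nullCovector_spaceEmbed, radius_spheroidalY a hr]
  have k1 : r₀ * spheroidalY a r₀ ϑ φ 0 + a * spheroidalY a r₀ ϑ φ 1 =
      (r₀ ^ 2 + a ^ 2) * (cos φ * sin ϑ) := by
    simp only [spheroidalY_apply_zero, spheroidalY_apply_one]; ring
  have k2 : r₀ * spheroidalY a r₀ ϑ φ 1 - a * spheroidalY a r₀ ϑ φ 0 =
      (r₀ ^ 2 + a ^ 2) * (sin φ * sin ϑ) := by
    simp only [spheroidalY_apply_zero, spheroidalY_apply_one]; ring
  rw [k1, k2, spheroidalY_apply_two]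
  have h1 : r₀ ^ 2 + a ^ 2 ≠ 0 := by positivity
  rw [div_add_div _ _ h1 hr.ne', div_eq_iff (mul_ne_zero h1 hr.ne')]
  ring

/-- `ℓ(∂_ϑ) = 0` on the ellipsoid. [folklore] -/
theorem nullCovector_spheroidalDTheta (a : ℝ) {r₀ : ℝ} (hr : 0 < r₀) (ϑ φ : ℝ) :
    nullCovector a (E4.ofTimeSpace 0 (spheroidalY a r₀ ϑ φ))
      (E4.spaceEmbed (spheroidalDTheta a r₀ ϑ φ)) = 0 := by
  rw [nullCovector_spheroidalY a hr, spheroidalDTheta_apply_zero, spheroidalDTheta_apply_one,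
    spheroidalDTheta_apply_two]
  linear_combination r₀ * sin ϑ * cos ϑ * sin_sq_add_cos_sq φ

/-- `ℓ(∂_φ) = −a sin² ϑ` on the ellipsoid (`ℓ = dt* + dr − a sin²ϑ dφ` in Kerr's ingoing
coordinates; Visser arXiv:0706.0622, (29)). [cite: arXiv07060622, (29)] -/
theorem nullCovector_spheroidalDPhi (a : ℝ) {r₀ : ℝ} (hr : 0 < r₀) (ϑ φ : ℝ) :
    nullCovector a (E4.ofTimeSpace 0 (spheroidalY a r₀ ϑ φ))
      (E4.spaceEmbed (spheroidalDPhi a r₀ ϑ φ)) = -(a * sin ϑ ^ 2) := by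
  rw [nullCovector_spheroidalY a hr, spheroidalDPhi_apply_zero, spheroidalDPhi_apply_one,
    spheroidalDPhi_apply_two]
  linear_combination (-(a * sin ϑ ^ 2)) * sin_sq_add_cos_sq φ

/-- `η((0, v), (0, w)) = v · w` on `E3`. [folklore] -/
theorem minkowski_spaceEmbed (v w : E3) :
    Minkowski.bilin (E4.spaceEmbed v) (E4.spaceEmbed w) = v 0 * w 0 + v 1 * w 1 + v 2 * w 2 := by
  simp [Fin.sum_univ_three]

/-- **`g(∂_ϑ, ∂_ϑ) = Σ = r₀² + a² cos² ϑ`** on the ellipsoid for `g = η + 2Hℓ ⊗ ℓ` (`ℓ(∂_ϑ) = 0`):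
the `g_{ϑϑ}` of the Boyer–Lindquist form, Wald 1984, (12.3.1). [cite: Wald1984GR, §12.3 eq. (12.3.1)] -/
theorem bilin_dTheta_dTheta (M a : ℝ) {r₀ : ℝ} (hr : 0 < r₀) (ϑ φ : ℝ) :
    bilin M a (E4.ofTimeSpace 0 (spheroidalY a r₀ ϑ φ))
        (E4.spaceEmbed (spheroidalDTheta a r₀ ϑ φ)) (E4.spaceEmbed (spheroidalDTheta a r₀ ϑ φ)) =
      r₀ ^ 2 + a ^ 2 * cos ϑ ^ 2 := by
  rw [bilin_apply, nullCovector_spheroidalDTheta a hr, minkowski_spaceEmbed,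
    spheroidalDTheta_apply_zero, spheroidalDTheta_apply_one, spheroidalDTheta_apply_two]
  linear_combination (r₀ ^ 2 + a ^ 2) * cos ϑ ^ 2 * sin_sq_add_cos_sq φ +
    r₀ ^ 2 * sin_sq_add_cos_sq ϑ

/-- **`g(∂_ϑ, ∂_φ) = 0`** on the ellipsoid (Boyer–Lindquist form, Wald 1984, (12.3.1)).
[cite: Wald1984GR, §12.3 eq. (12.3.1)] -/
theorem bilin_dTheta_dPhi (M a : ℝ) {r₀ : ℝ} (hr : 0 < r₀) (ϑ φ : ℝ) :
    bilin M a (E4.ofTimeSpace 0 (spheroidalY a r₀ ϑ φ))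
        (E4.spaceEmbed (spheroidalDTheta a r₀ ϑ φ)) (E4.spaceEmbed (spheroidalDPhi a r₀ ϑ φ)) =
      0 := by
  rw [bilin_apply, nullCovector_spheroidalDTheta a hr, minkowski_spaceEmbed,
    spheroidalDTheta_apply_zero, spheroidalDTheta_apply_one, spheroidalDTheta_apply_two,
    spheroidalDPhi_apply_zero, spheroidalDPhi_apply_one, spheroidalDPhi_apply_two]
  ring

/-- **`g(∂_φ, ∂_φ) = (r₀² + a²) sin² ϑ + 2 (M r₀/Σ) a² sin⁴ ϑ`** on the ellipsoid (Kerr–Schild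
form: `η(∂_φ, ∂_φ) = (r₀² + a²) sin² ϑ`, `ℓ(∂_φ) = −a sin² ϑ`, `H = M r₀/Σ`). [cite: arXiv07060622, (33)] -/
theorem bilin_dPhi_dPhi (M a : ℝ) {r₀ : ℝ} (hr : 0 < r₀) (ϑ φ : ℝ) :
    bilin M a (E4.ofTimeSpace 0 (spheroidalY a r₀ ϑ φ))
        (E4.spaceEmbed (spheroidalDPhi a r₀ ϑ φ)) (E4.spaceEmbed (spheroidalDPhi a r₀ ϑ φ)) =
      (r₀ ^ 2 + a ^ 2) * sin ϑ ^ 2 +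
        2 * (M * r₀ / (r₀ ^ 2 + a ^ 2 * cos ϑ ^ 2)) * (a * sin ϑ ^ 2) ^ 2 := by
  rw [bilin_apply, nullCovector_spheroidalDPhi a hr, minkowski_spaceEmbed,
    scalarH_spheroidalY M a hr, spheroidalDPhi_apply_zero, spheroidalDPhi_apply_one,
    spheroidalDPhi_apply_two]
  linear_combination (r₀ ^ 2 + a ^ 2) * sin ϑ ^ 2 * sin_sq_add_cos_sq φ

/-- **Boyer–Lindquist form of `g(∂_φ, ∂_φ)`**: `((r₀² + a²)² − Δ(r₀) a² sin² ϑ) sin² ϑ / Σ`,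
`Δ = r² − 2Mr + a²`, `Σ = r₀² + a² cos² ϑ` — the `t`-sections of `{r = r₀}` in Kerr–Schild time
are isometric to the Boyer–Lindquist ones. Wald 1984, (12.3.1). [cite: Wald1984GR, §12.3 eq. (12.3.1)] -/
theorem bilin_dPhi_dPhi_eq_boyerLindquist (M a : ℝ) {r₀ : ℝ} (hr : 0 < r₀) (ϑ φ : ℝ) :
    bilin M a (E4.ofTimeSpace 0 (spheroidalY a r₀ ϑ φ))
        (E4.spaceEmbed (spheroidalDPhi a r₀ ϑ φ)) (E4.spaceEmbed (spheroidalDPhi a r₀ ϑ φ)) =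
      ((r₀ ^ 2 + a ^ 2) ^ 2 - delta M a r₀ * a ^ 2 * sin ϑ ^ 2) * sin ϑ ^ 2 /
        (r₀ ^ 2 + a ^ 2 * cos ϑ ^ 2) := by
  have hS := (blSigma_spheroidalY_pos a hr ϑ).ne'
  rw [bilin_dPhi_dPhi M a hr, delta]
  rw [Real.cos_sq'] at hS ⊢
  rw [eq_div_iff hS]
  field_simp
  ring

/-- **The Gram determinant of the induced `2`-metric on `{t* = 0, r = r₀}`**:
`g_{ϑϑ} g_{φφ} − g_{ϑφ}² = ((r₀² + a²)² − Δ(r₀) a² sin² ϑ) sin² ϑ` — the square of the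
Boyer–Lindquist area element of `{r = r₀}` (Wald 1984, (12.3.1)). [cite: Wald1984GR, §12.3 eq. (12.3.1)] -/
theorem gram_spheroidal (M a : ℝ) {r₀ : ℝ} (hr : 0 < r₀) (ϑ φ : ℝ) :
    bilin M a (E4.ofTimeSpace 0 (spheroidalY a r₀ ϑ φ))
          (E4.spaceEmbed (spheroidalDTheta a r₀ ϑ φ)) (E4.spaceEmbed (spheroidalDTheta a r₀ ϑ φ)) *
        bilin M a (E4.ofTimeSpace 0 (spheroidalY a r₀ ϑ φ))
          (E4.spaceEmbed (spheroidalDPhi a r₀ ϑ φ)) (E4.spaceEmbed (spheroidalDPhi a r₀ ϑ φ)) -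
      bilin M a (E4.ofTimeSpace 0 (spheroidalY a r₀ ϑ φ))
          (E4.spaceEmbed (spheroidalDTheta a r₀ ϑ φ)) (E4.spaceEmbed (spheroidalDPhi a r₀ ϑ φ)) ^ 2 =
      ((r₀ ^ 2 + a ^ 2) ^ 2 - delta M a r₀ * a ^ 2 * sin ϑ ^ 2) * sin ϑ ^ 2 := by
  have hS : r₀ ^ 2 + a ^ 2 * cos ϑ ^ 2 ≠ 0 := (blSigma_spheroidalY_pos a hr ϑ).ne'
  rw [bilin_dTheta_dTheta M a hr, bilin_dTheta_dPhi M a hr, bilin_dPhi_dPhi_eq_boyerLindquist M a hr]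
  field_simp
  ring

/-- **Inside the black hole the area element dominates the round one**: where `Δ(r₀) ≤ 0`
(`r₋ ≤ r₀ ≤ r₊`) the Gram determinant on `{t* = 0, r = r₀}` is at least `(r₀² + a²)² sin² ϑ`, the
squared area element of a round sphere of area `4π(r₀² + a²)` (equality iff `Δ a sin ϑ = 0`). [folklore] -/
theorem round_le_gram_spheroidal (M a : ℝ) {r₀ : ℝ} (hr : 0 < r₀) (hΔ : delta M a r₀ ≤ 0)
    (ϑ φ : ℝ) :
    (r₀ ^ 2 + a ^ 2) ^ 2 * sin ϑ ^ 2 ≤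
      bilin M a (E4.ofTimeSpace 0 (spheroidalY a r₀ ϑ φ))
            (E4.spaceEmbed (spheroidalDTheta a r₀ ϑ φ)) (E4.spaceEmbed (spheroidalDTheta a r₀ ϑ φ)) *
          bilin M a (E4.ofTimeSpace 0 (spheroidalY a r₀ ϑ φ))
            (E4.spaceEmbed (spheroidalDPhi a r₀ ϑ φ)) (E4.spaceEmbed (spheroidalDPhi a r₀ ϑ φ)) -
        bilin M a (E4.ofTimeSpace 0 (spheroidalY a r₀ ϑ φ))
            (E4.spaceEmbed (spheroidalDTheta a r₀ ϑ φ)) (E4.spaceEmbed (spheroidalDPhi a r₀ ϑ φ)) ^ 2 := by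
  rw [gram_spheroidal M a hr]
  have : 0 ≤ -delta M a r₀ * a ^ 2 * sin ϑ ^ 2 * sin ϑ ^ 2 := by
    have h1 : 0 ≤ -delta M a r₀ := by linarith
    positivity
  nlinarith

/-- **On the horizon the area element is exactly round**: at `r₀ = r₊` (`|a| ≤ M`, `0 < M`) the
Gram determinant is `(r₊² + a²)² sin² ϑ = (2 M r₊)² sin² ϑ`. [cite: Wald1984GR, §12.5 eq. (12.5.21)] -/
theorem gram_spheroidal_rPlus {M a : ℝ} (h : |a| ≤ M) (hM : 0 < M) (ϑ φ : ℝ) :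
    bilin M a (E4.ofTimeSpace 0 (spheroidalY a (rPlus M a) ϑ φ))
          (E4.spaceEmbed (spheroidalDTheta a (rPlus M a) ϑ φ))
          (E4.spaceEmbed (spheroidalDTheta a (rPlus M a) ϑ φ)) *
        bilin M a (E4.ofTimeSpace 0 (spheroidalY a (rPlus M a) ϑ φ))
          (E4.spaceEmbed (spheroidalDPhi a (rPlus M a) ϑ φ))
          (E4.spaceEmbed (spheroidalDPhi a (rPlus M a) ϑ φ)) -
      bilin M a (E4.ofTimeSpace 0 (spheroidalY a (rPlus M a) ϑ φ))
          (E4.spaceEmbed (spheroidalDTheta a (rPlus M a) ϑ φ))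
          (E4.spaceEmbed (spheroidalDPhi a (rPlus M a) ϑ φ)) ^ 2 =
      (2 * M * rPlus M a) ^ 2 * sin ϑ ^ 2 := by
  rw [gram_spheroidal M a (rPlus_pos hM a), delta_rPlus h, rPlus_sq_add_sq h]
  ring

/-! ## The Boyer–Lindquist section area `2π ∫₀^π √gram dϑ` -/

/-- The **area element** `√(((r₀² + a²)² − Δ(r₀) a² sin² ϑ) sin² ϑ)` of `{t* = 0, r = r₀}` (the
square root of the Gram determinant `gram_spheroidal`; independent of `φ`). [cite: Wald1984GR, §12.3 eq. (12.3.1)] -/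
def sectionAreaElement (M a r₀ ϑ : ℝ) : ℝ :=
  √(((r₀ ^ 2 + a ^ 2) ^ 2 - delta M a r₀ * a ^ 2 * sin ϑ ^ 2) * sin ϑ ^ 2)

/-- The **coordinate area** `|S_{r₀}| = 2π ∫₀^π √gram dϑ` of `{t* = 0, r = r₀}` (classical surface
area of the parametrised ellipsoid for the induced `2`-metric; its identification with the
Hausdorff area `area` of `Volume.lean` is not attempted). [cite: Wald1984GR, §12.5 eq. (12.5.21)] -/
def sectionArea (M a r₀ : ℝ) : ℝ :=
  2 * π * ∫ ϑ in (0 : ℝ)..π, sectionAreaElement M a r₀ ϑ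

/-- The area element squared is the Gram determinant of the induced `2`-metric (`0 < r₀`).
[folklore] -/
theorem sectionAreaElement_sq (M a : ℝ) {r₀ : ℝ} (hr : 0 < r₀) (hΔ : delta M a r₀ ≤ 0)
    (ϑ φ : ℝ) :
    sectionAreaElement M a r₀ ϑ ^ 2 =
      bilin M a (E4.ofTimeSpace 0 (spheroidalY a r₀ ϑ φ))
            (E4.spaceEmbed (spheroidalDTheta a r₀ ϑ φ)) (E4.spaceEmbed (spheroidalDTheta a r₀ ϑ φ)) *
          bilin M a (E4.ofTimeSpace 0 (spheroidalY a r₀ ϑ φ))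
            (E4.spaceEmbed (spheroidalDPhi a r₀ ϑ φ)) (E4.spaceEmbed (spheroidalDPhi a r₀ ϑ φ)) -
        bilin M a (E4.ofTimeSpace 0 (spheroidalY a r₀ ϑ φ))
            (E4.spaceEmbed (spheroidalDTheta a r₀ ϑ φ)) (E4.spaceEmbed (spheroidalDPhi a r₀ ϑ φ)) ^ 2 := by
  rw [gram_spheroidal M a hr, sectionAreaElement, Real.sq_sqrt]
  have : 0 ≤ -delta M a r₀ := by linarith
  refine mul_nonneg ?_ (sq_nonneg _)
  nlinarith [sq_nonneg (r₀ ^ 2 + a ^ 2),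
    mul_nonneg (mul_nonneg this (sq_nonneg a)) (sq_nonneg (sin ϑ))]

/-- The area element is continuous in `ϑ`. [folklore] -/
theorem continuous_sectionAreaElement (M a r₀ : ℝ) : Continuous (sectionAreaElement M a r₀) := by
  unfold sectionAreaElement
  fun_prop

/-- **Round lower bound for the area element inside the hole**: for `Δ(r₀) ≤ 0`,
`(r₀² + a²) sin ϑ ≤ √gram` (for `sin ϑ < 0` trivially). [folklore] -/
theorem round_le_sectionAreaElement (M a r₀ : ℝ) (hΔ : delta M a r₀ ≤ 0) (ϑ : ℝ) :
    (r₀ ^ 2 + a ^ 2) * sin ϑ ≤ sectionAreaElement M a r₀ ϑ := by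
  rw [sectionAreaElement]
  refine Real.le_sqrt_of_sq_le ?_
  have h1 : 0 ≤ -delta M a r₀ * a ^ 2 * sin ϑ ^ 2 * sin ϑ ^ 2 := by
    have : 0 ≤ -delta M a r₀ := by linarith
    positivity
  nlinarith

/-- **On the horizon the area element is round**: `√gram = 2 M r₊ sin ϑ` at `r₀ = r₊`
(`|a| ≤ M`, `0 ≤ M`, `0 ≤ sin ϑ`). [folklore] -/
theorem sectionAreaElement_rPlus {M a : ℝ} (h : |a| ≤ M) (hM : 0 ≤ M) {ϑ : ℝ} (hϑ : 0 ≤ sin ϑ) :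
    sectionAreaElement M a (rPlus M a) ϑ = 2 * M * rPlus M a * sin ϑ := by
  have hr : 0 ≤ rPlus M a := by unfold rPlus; positivity
  rw [sectionAreaElement, delta_rPlus h, rPlus_sq_add_sq h,
    show ((2 * M * rPlus M a) ^ 2 - 0 * a ^ 2 * sin ϑ ^ 2) * sin ϑ ^ 2 =
      (2 * M * rPlus M a * sin ϑ) ^ 2 by ring, Real.sqrt_sq (mul_nonneg (by positivity) hϑ)]

/-- **Inside the black hole the coordinate spheres are at least as large as the round sphere of
area radius `√(r₀² + a²)`**: `4π(r₀² + a²) ≤ |S_{r₀}|` wherever `Δ(r₀) ≤ 0`. [folklore] -/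
theorem le_sectionArea (M a r₀ : ℝ) (hΔ : delta M a r₀ ≤ 0) :
    4 * π * (r₀ ^ 2 + a ^ 2) ≤ sectionArea M a r₀ := by
  have hmono : ∫ ϑ in (0 : ℝ)..π, (r₀ ^ 2 + a ^ 2) * sin ϑ ≤
      ∫ ϑ in (0 : ℝ)..π, sectionAreaElement M a r₀ ϑ :=
    intervalIntegral.integral_mono_on Real.pi_pos.le
      ((continuous_const.mul Real.continuous_sin).intervalIntegrable _ _)
      ((continuous_sectionAreaElement M a r₀).intervalIntegrable _ _)
      fun ϑ _ ↦ round_le_sectionAreaElement M a r₀ hΔ ϑ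
  rw [intervalIntegral.integral_const_mul, integral_sin, Real.cos_zero, Real.cos_pi] at hmono
  rw [sectionArea]
  nlinarith [Real.pi_pos]

/-- **The Kerr horizon area**: `|S_{r₊}| = 8π M r₊(M, a)` (`= 4π(r₊² + a²)`; Wald 1984,
(12.5.21)), for `|a| ≤ M`, `0 ≤ M`. [cite: Wald1984GR, §12.5 eq. (12.5.21)] -/
theorem sectionArea_rPlus {M a : ℝ} (h : |a| ≤ M) (hM : 0 ≤ M) :
    sectionArea M a (rPlus M a) = 8 * π * (M * rPlus M a) := by
  have hcongr : ∫ ϑ in (0 : ℝ)..π, sectionAreaElement M a (rPlus M a) ϑ =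
      ∫ ϑ in (0 : ℝ)..π, 2 * M * rPlus M a * sin ϑ := by
    refine intervalIntegral.integral_congr fun ϑ hϑ ↦ ?_
    rw [Set.uIcc_of_le Real.pi_pos.le] at hϑ
    exact sectionAreaElement_rPlus h hM (Real.sin_nonneg_of_mem_Icc hϑ)
  rw [sectionArea, hcongr, intervalIntegral.integral_const_mul, integral_sin, Real.cos_zero,
    Real.cos_pi]
  ring

end Kerr

end Literature.Geometry.Lorentzian
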